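import Summits.HubbardSuperconductivity.HubbardSuperconductivity.Theorems.AnisotropyChordTransferFibre3GreenZeroConstant
import Summits.HubbardSuperconductivity.HubbardSuperconductivity.Theorems.AnisotropyChordTransferFibre3S2Bracket
import Summits.HubbardSuperconductivity.HubbardSuperconductivity.Theorems.AnisotropyChordTransferFibre3RingCountUpper
import Summits.HubbardSuperconductivity.HubbardSuperconductivity.Theorems.AnisotropyChordTransferFibre3ShellWeight

/-!
# Route `AnisotropyChord` / H0 rotor rung: the capacity in the KT regime `λ = ν(2π/L)²` — `G̃_λ(0) = ln L/(2π) + [0.0456 + 0.1266ν, 0.0510 + 0.234ν]` (family A, LEMMA A0, `L ≥ 64`, `0 ≤ ν ≤ 0.07`)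

Completes family-A row 1 of LEVEL2-SPEC §3 (the one-propagator capacity `G_λ(0)` in the KT regime, precision needed ±.01):
* `excess_bracket`: the λ-EXCESS is bracketed by the two-propagator sum, `λ·S₂(0)/V ≤ G̃_λ(0) − G̃₀(0) ≤ λ·S₂(λ)/V`
  (termwise `λ/(2ε)² ≤ 1/(2ε−λ) − 1/(2ε) ≤ λ/(2ε−λ)²`);
* p3 g2's L-UNIFORM bracket `s2UniformBracket_holds` (…S2Bracket) at `L₀ = 64`: `xi2lo ν 16 ≤ 16π⁴S₂/L⁴ ≤ xi2hi ν (π/32) 16`;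
* the elementary numerics `xi2lo 0 16 ≥ 5` (first shell) and `xi2hi ν (π/32) 16 ≤ 9.2` for `ν ≤ 0.07` (first shell explicit,
  the rest by `sum_sdiff_one_sq_le` of …RingCountUpper, the `ℤ²` tail constant);
* the `λ = 0` constant `capacity_const_bounds` (…GreenZeroConstant).
Result ★ `capacity_KT_bounds`: for `L ≥ 64`, `0 ≤ ν ≤ 0.07`, `λ = ν(2π/L)²`:
**`0.0456 + 0.1266ν ≤ G̃_λ(0) − ln L/(2π) ≤ 0.0510 + 0.234ν`** (truth: `c(ν) = 0.04877 + 0.153ν + O(ν²)`, `c(.07) = .0601`).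
Prover seat `hubbard-h0-rotor-p1` g26; helper for stmt-HubbardSuperconductivity-23918 (`--supports`, helper class).
WHAT THIS IS NOT: nothing here proves superconductivity in the Hubbard model; one analytic input (family A) of the Level-2 programme for
ONE conditional reduction (piece A of the H0/PC rotor rung).  Tree imports only; no new definitions; no sorry, no axioms.
-/

set_option linter.dupNamespace false
set_option autoImplicit false

noncomputable section

open scoped BigOperators
open Real Finset

namespace Summit.HubbardSuperconductivity.HubbardSuperconductivity.Theorems.AnisotropyChord.Transfer.Fibre3

namespace CapacityConst

variable (L : ℕ) [NeZero L]

/-! ## The λ-excess bracketed by `S₂` -/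

/-- ★ `λ·S₂(0)/V ≤ G̃_λ(0) − G̃₀(0) ≤ λ·S₂(λ)/V` for `0 ≤ λ < 2ε₁`, `L ≥ 2`. [folklore] -/
theorem excess_bracket (hL : 2 ≤ L) (lam : ℝ) (h0 : 0 ≤ lam) (h1 : lam < 2 * eps1 L) :
    lam * S2sum L 0 / (L : ℝ) ^ 2 ≤ Gres L lam 0 - Gres L 0 0 ∧
      Gres L lam 0 - Gres L 0 0 ≤ lam * S2sum L lam / (L : ℝ) ^ 2 := by
  have hV : (0 : ℝ) < (L : ℝ) ^ 2 := by
    have : (0 : ℝ) < L := by exact_mod_cast (show 0 < L by omega)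
    positivity
  have hphase : ∀ k : Tor L, (phase L k 0).re = 1 := by
    intro k; rw [RateLemma.phase_re]; simp
  have hG : ∀ μ : ℝ, Gres L μ 0 = (∑ k : Tor L, gres L μ k) / (L : ℝ) ^ 2 := by
    intro μ; unfold Gres
    congr 1
    exact Finset.sum_congr rfl (fun k _ => by rw [hphase k, mul_one])
  rw [hG lam, hG 0, ← sub_div, ← Finset.sum_sub_distrib]
  unfold S2sum
  -- termwise
  have hterm : ∀ k : Tor L,
      lam * gres L 0 k ^ 2 ≤ gres L lam k - gres L 0 k ∧ gres L lam k - gres L 0 k ≤ lam * gres L lam k ^ 2 := by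
    intro k
    by_cases hk : k = 0
    · subst hk; simp [gres]
    · have hε : eps1 L ≤ epsT L k := eps1_le_epsT L hL hk
      have ha : 0 < 2 * epsT L k := by linarith [RateLemma.eps1_pos_of_two_le L hL]
      have hb : 0 < 2 * epsT L k - lam := by linarith
      simp only [gres, if_neg hk, sub_zero]
      have hε0 : epsT L k ≠ 0 := by
        have : 0 < epsT L k := by linarith
        exact this.ne'
      have e : 1 / (2 * epsT L k - lam) - 1 / (2 * epsT L k)
          = lam / ((2 * epsT L k) * (2 * epsT L k - lam)) := by
        rw [div_sub_div _ _ hb.ne' ha.ne', div_eq_div_iff (mul_ne_zero hb.ne' ha.ne') (mul_ne_zero ha.ne' hb.ne')]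
        ring
      rw [e]
      constructor
      · rw [div_pow, one_pow, ← div_eq_mul_one_div, div_le_div_iff₀ (by positivity) (by positivity)]
        have : (2 * epsT L k) * (2 * epsT L k - lam) ≤ (2 * epsT L k) ^ 2 := by nlinarith
        exact mul_le_mul_of_nonneg_left this h0
      · rw [div_pow, one_pow, ← div_eq_mul_one_div, div_le_div_iff₀ (by positivity) (by positivity)]
        have : (2 * epsT L k - lam) ^ 2 ≤ (2 * epsT L k) * (2 * epsT L k - lam) := by nlinarith
        exact mul_le_mul_of_nonneg_left this h0
  constructor
  · apply div_le_div_of_nonneg_right _ hV.le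
    rw [Finset.mul_sum]
    exact Finset.sum_le_sum (fun k _ => (hterm k).1)
  · apply div_le_div_of_nonneg_right _ hV.le
    rw [Finset.mul_sum]
    exact Finset.sum_le_sum (fun k _ => (hterm k).2)

/-! ## Numerics of the uniform `S₂` brackets at `L₀ = 64` -/

/-- the first shell as an explicit finset. [folklore] -/
theorem puncturedBox_one_eq :
    RateLemma.puncturedBox 1 = {(1, 0), (-1, 0), (0, 1), (0, -1), (1, 1), (1, -1), (-1, 1), (-1, -1)} := by
  decide

/-- a sum over the first shell, expanded. [folklore] -/
theorem sum_puncturedBox_one (f : ℤ × ℤ → ℝ) :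
    ∑ p ∈ RateLemma.puncturedBox 1, f p
      = f (1, 0) + f (-1, 0) + f (0, 1) + f (0, -1) + f (1, 1) + f (1, -1) + f (-1, 1) + f (-1, -1) := by
  rw [puncturedBox_one_eq]
  rw [Finset.sum_insert (by decide), Finset.sum_insert (by decide), Finset.sum_insert (by decide),
    Finset.sum_insert (by decide), Finset.sum_insert (by decide), Finset.sum_insert (by decide),
    Finset.sum_insert (by decide), Finset.sum_singleton]
  ring

/-- `zWindow` is the punctured box of …RateLemma. [folklore] -/
theorem zWindow_eq (K : ℕ) : zWindow K = RateLemma.puncturedBox K := rfl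

/-- `xi2lo 0 16 ≥ 5` (the first shell alone). [folklore] -/
theorem xi2lo_zero_ge : (5 : ℝ) ≤ xi2lo 0 16 := by
  unfold xi2lo
  rw [zWindow_eq]
  have hsub : RateLemma.puncturedBox 1 ⊆ RateLemma.puncturedBox 16 := puncturedBox_subset (by norm_num)
  have hnn : ∀ p ∈ RateLemma.puncturedBox 16, p ∉ RateLemma.puncturedBox 1 →
      0 ≤ 1 / (((p.1 : ℝ) ^ 2 + (p.2 : ℝ) ^ 2) - 0) ^ 2 := by
    intro p _ _; positivity
  refine le_trans ?_ (Finset.sum_le_sum_of_subset_of_nonneg hsub hnn)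
  rw [sum_puncturedBox_one]
  norm_num

/-- `xi2hi ν (π/32) 16 ≤ 9.2` for `0 ≤ ν ≤ 0.07`. [folklore] -/
theorem xi2hi_le (ν : ℝ) (hν0 : 0 ≤ ν) (hν : ν ≤ 0.07) : xi2hi ν (2 * Real.pi / 64) 16 ≤ 9.2 := by
  have hπlo := Real.pi_gt_d6
  have hπhi := Real.pi_lt_d6
  set θ0 : ℝ := 2 * Real.pi / 64 with hθ0
  have hθ2 : θ0 ^ 2 ≤ 0.00964 := by
    rw [hθ0]; nlinarith
  have hθ2' : 0 ≤ θ0 ^ 2 := by positivity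
  unfold xi2hi
  rw [zWindow_eq]
  -- split the window into the first shell and the rest
  have hsub : RateLemma.puncturedBox 1 ⊆ RateLemma.puncturedBox 16 := puncturedBox_subset (by norm_num)
  rw [← Finset.sum_sdiff hsub]
  -- (a) the rest: each term `≤ C/|p|⁴`, `C = 1/(κ − ν/4)²`, `κ = 1 − 256 θ₀²/12`
  set κ : ℝ := 1 - θ0 ^ 2 * 256 / 12 with hκ
  have hκlo : 0.776 ≤ κ - ν / 4 := by rw [hκ]; linarith
  have hrest : ∀ p ∈ RateLemma.puncturedBox 16 \ RateLemma.puncturedBox 1,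
      1 / (((p.1 : ℝ) ^ 2 * (1 - θ0 ^ 2 * (p.1 : ℝ) ^ 2 / 12) + (p.2 : ℝ) ^ 2 * (1 - θ0 ^ 2 * (p.2 : ℝ) ^ 2 / 12)) - ν) ^ 2
        ≤ (1 / 0.776 ^ 2) * (1 / (((p.1 ^ 2 + p.2 ^ 2 : ℤ)) : ℝ)) ^ 2 := by
    intro p hp
    rw [Finset.mem_sdiff, RateLemma.mem_puncturedBox, RateLemma.mem_puncturedBox] at hp
    obtain ⟨⟨hp0, ⟨h1, h2⟩, ⟨h3, h4⟩⟩, hnot⟩ := hp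
    push_cast at h1 h2 h3 h4
    -- `|p|² ≥ 4` since `p ∉` the first shell and `p ≠ 0`
    have hfar : (4 : ℤ) ≤ p.1 ^ 2 + p.2 ^ 2 := by
      by_contra hlt
      push Not at hlt
      apply hnot
      refine ⟨hp0, ⟨?_, ?_⟩, ⟨?_, ?_⟩⟩ <;> push_cast <;> nlinarith [sq_nonneg p.1, sq_nonneg p.2, sq_nonneg (p.1 - 1), sq_nonneg (p.1+1), sq_nonneg (p.2-1), sq_nonneg (p.2+1)]
    have hfarR : (4 : ℝ) ≤ (p.1 : ℝ) ^ 2 + (p.2 : ℝ) ^ 2 := by exact_mod_cast hfar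
    have hp1 : (p.1 : ℝ) ^ 2 ≤ 256 := by
      have : p.1 ^ 2 ≤ 256 := by nlinarith [mul_nonneg (sub_nonneg.mpr h2) (show (0:ℤ) ≤ p.1 + 16 by linarith)]
      exact_mod_cast this
    have hp2 : (p.2 : ℝ) ^ 2 ≤ 256 := by
      have : p.2 ^ 2 ≤ 256 := by nlinarith [mul_nonneg (sub_nonneg.mpr h4) (show (0:ℤ) ≤ p.2 + 16 by linarith)]
      exact_mod_cast this
    have ha1 : κ ≤ 1 - θ0 ^ 2 * (p.1 : ℝ) ^ 2 / 12 := by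
      rw [hκ]; linarith [mul_le_mul_of_nonneg_left hp1 hθ2']
    have ha2 : κ ≤ 1 - θ0 ^ 2 * (p.2 : ℝ) ^ 2 / 12 := by
      rw [hκ]; linarith [mul_le_mul_of_nonneg_left hp2 hθ2']
    set N : ℝ := (p.1 : ℝ) ^ 2 + (p.2 : ℝ) ^ 2 with hN
    have hD : (κ - ν / 4) * N
        ≤ ((p.1 : ℝ) ^ 2 * (1 - θ0 ^ 2 * (p.1 : ℝ) ^ 2 / 12) + (p.2 : ℝ) ^ 2 * (1 - θ0 ^ 2 * (p.2 : ℝ) ^ 2 / 12)) - ν := by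
      have e1 : κ * N ≤ (p.1 : ℝ) ^ 2 * (1 - θ0 ^ 2 * (p.1 : ℝ) ^ 2 / 12) + (p.2 : ℝ) ^ 2 * (1 - θ0 ^ 2 * (p.2 : ℝ) ^ 2 / 12) := by
        rw [hN, mul_add]
        exact add_le_add
          (by rw [mul_comm]; exact mul_le_mul_of_nonneg_left ha1 (sq_nonneg _))
          (by rw [mul_comm]; exact mul_le_mul_of_nonneg_left ha2 (sq_nonneg _))
      have e2 : ν ≤ ν / 4 * N := by
        have := mul_le_mul_of_nonneg_left hfarR hν0
        linarith
      linarith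
    have hDpos : 0 < (κ - ν / 4) * N := by
      have : 0 < N := by linarith
      have : 0 < κ - ν / 4 := by linarith
      positivity
    have hcast : (((p.1 ^ 2 + p.2 ^ 2 : ℤ)) : ℝ) = N := by rw [hN]; push_cast; ring
    rw [hcast]
    calc 1 / (((p.1 : ℝ) ^ 2 * (1 - θ0 ^ 2 * (p.1 : ℝ) ^ 2 / 12) + (p.2 : ℝ) ^ 2 * (1 - θ0 ^ 2 * (p.2 : ℝ) ^ 2 / 12)) - ν) ^ 2
        ≤ 1 / ((κ - ν / 4) * N) ^ 2 := by
          apply one_div_le_one_div_of_le (by positivity)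
          exact pow_le_pow_left₀ hDpos.le hD 2
      _ = (1 / (κ - ν / 4) ^ 2) * (1 / N) ^ 2 := by
          field_simp
      _ ≤ (1 / 0.776 ^ 2) * (1 / N) ^ 2 := by
          apply mul_le_mul_of_nonneg_right _ (by positivity)
          apply one_div_le_one_div_of_le (by norm_num)
          exact pow_le_pow_left₀ (by norm_num) hκlo 2
  have hrest_sum : ∑ p ∈ RateLemma.puncturedBox 16 \ RateLemma.puncturedBox 1,
      1 / (((p.1 : ℝ) ^ 2 * (1 - θ0 ^ 2 * (p.1 : ℝ) ^ 2 / 12) + (p.2 : ℝ) ^ 2 * (1 - θ0 ^ 2 * (p.2 : ℝ) ^ 2 / 12)) - ν) ^ 2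
        ≤ (1 / 0.776 ^ 2) * 1.9853 := by
    refine (Finset.sum_le_sum hrest).trans ?_
    rw [← Finset.mul_sum]
    apply mul_le_mul_of_nonneg_left _ (by norm_num)
    have h := sum_sdiff_one_sq_le 16 (by norm_num)
    norm_num at h ⊢
    linarith
  -- (b) the first shell: termwise `≤ 1.1585` on the axes, `≤ 0.2690` on the corners
  have hshell_term : ∀ p ∈ RateLemma.puncturedBox 1,
      1 / (((p.1 : ℝ) ^ 2 * (1 - θ0 ^ 2 * (p.1 : ℝ) ^ 2 / 12) + (p.2 : ℝ) ^ 2 * (1 - θ0 ^ 2 * (p.2 : ℝ) ^ 2 / 12)) - ν) ^ 2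
        ≤ if p.1 = 0 ∨ p.2 = 0 then 1.1585 else 0.2690 := by
    intro p hp
    rw [RateLemma.mem_puncturedBox] at hp
    obtain ⟨hp0, ⟨h1, h2⟩, ⟨h3, h4⟩⟩ := hp
    push_cast at h1 h2 h3 h4
    have hsq1 : p.1 = 0 ∨ p.1 ^ 2 = 1 := by
      rcases (show p.1 = -1 ∨ p.1 = 0 ∨ p.1 = 1 by omega) with h | h | h <;> simp [h]
    have hsq2 : p.2 = 0 ∨ p.2 ^ 2 = 1 := by
      rcases (show p.2 = -1 ∨ p.2 = 0 ∨ p.2 = 1 by omega) with h | h | h <;> simp [h]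
    have hα : 0.99919 ≤ 1 - θ0 ^ 2 / 12 := by linarith
    split_ifs with hax
    · -- axis: one coordinate vanishes, the other has square 1
      have hN : ((p.1 : ℝ) ^ 2 = 0 ∧ (p.2 : ℝ) ^ 2 = 1) ∨ ((p.1 : ℝ) ^ 2 = 1 ∧ (p.2 : ℝ) ^ 2 = 0) := by
        rcases hax with h0 | h0
        · left
          have : p.2 ^ 2 = 1 := by
            rcases hsq2 with h | h
            · exfalso; apply hp0; ext <;> simp [h0, h]
            · exact h
          exact ⟨by rw [h0]; simp, by exact_mod_cast this⟩
        · right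
          have : p.1 ^ 2 = 1 := by
            rcases hsq1 with h | h
            · exfalso; apply hp0; ext <;> simp [h0, h]
            · exact h
          exact ⟨by exact_mod_cast this, by rw [h0]; simp⟩
      have hD : 0.9291 ≤ ((p.1 : ℝ) ^ 2 * (1 - θ0 ^ 2 * (p.1 : ℝ) ^ 2 / 12)
          + (p.2 : ℝ) ^ 2 * (1 - θ0 ^ 2 * (p.2 : ℝ) ^ 2 / 12)) - ν := by
        rcases hN with ⟨e1, e2⟩ | ⟨e1, e2⟩ <;>
        · rw [e1, e2]; simp only [zero_mul, one_mul, mul_zero, mul_one, zero_add, add_zero, zero_div]; linarith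
      exact one_div_le_of _ (0.9291 ^ 2) _ (by norm_num) (pow_le_pow_left₀ (by norm_num) hD 2) (by norm_num)
    · -- corner: both squares are 1
      push Not at hax
      have e1 : (p.1 : ℝ) ^ 2 = 1 := by
        rcases hsq1 with h | h
        · exact absurd h hax.1
        · exact_mod_cast h
      have e2 : (p.2 : ℝ) ^ 2 = 1 := by
        rcases hsq2 with h | h
        · exact absurd h hax.2
        · exact_mod_cast h
      have hD : 1.9283 ≤ ((p.1 : ℝ) ^ 2 * (1 - θ0 ^ 2 * (p.1 : ℝ) ^ 2 / 12)
          + (p.2 : ℝ) ^ 2 * (1 - θ0 ^ 2 * (p.2 : ℝ) ^ 2 / 12)) - ν := by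
        rw [e1, e2]; simp only [one_mul, mul_one]; linarith
      exact one_div_le_of _ (1.9283 ^ 2) _ (by norm_num) (pow_le_pow_left₀ (by norm_num) hD 2) (by norm_num)
  have hshell : ∑ p ∈ RateLemma.puncturedBox 1,
      1 / (((p.1 : ℝ) ^ 2 * (1 - θ0 ^ 2 * (p.1 : ℝ) ^ 2 / 12) + (p.2 : ℝ) ^ 2 * (1 - θ0 ^ 2 * (p.2 : ℝ) ^ 2 / 12)) - ν) ^ 2 ≤ 5.71 := by
    refine (Finset.sum_le_sum hshell_term).trans ?_
    rw [sum_puncturedBox_one]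
    norm_num
  -- (c) the tail constant
  have htail : (Real.pi ^ 5 / 16) / ((((16 : ℕ) : ℝ) - 1) ^ 2 - ν * Real.pi ^ 2 / 4) ≤ 0.0852 := by
    have hπ2 : Real.pi ^ 2 ≤ 9.8697 := by nlinarith
    have hπ5 : Real.pi ^ 5 ≤ 306.03 := by
      have h3 : Real.pi ^ 3 ≤ 31.0063 := by nlinarith
      nlinarith
    have hden : (224.8 : ℝ) ≤ (((16 : ℕ) : ℝ) - 1) ^ 2 - ν * Real.pi ^ 2 / 4 := by
      push_cast; nlinarith
    rw [div_le_iff₀ (by linarith)]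
    nlinarith
  -- assemble
  have hsplit := add_le_add hrest_sum hshell
  norm_num at hsplit htail ⊢
  linarith

/-! ## ★ The capacity in the KT regime -/

/-- ★★★ **LEMMA A0 in the KT regime**: for `L ≥ 64`, `0 ≤ ν ≤ 0.07`, `λ = ν(2π/L)²`:
`0.0456 + 0.1266ν ≤ G̃_λ(0) − ln L/(2π) ≤ 0.0510 + 0.234ν`. [folklore] -/
theorem capacity_KT_bounds (hL : 64 ≤ L) (ν : ℝ) (hν0 : 0 ≤ ν) (hν : ν ≤ 0.07) :
    0.0456 + 0.1266 * ν ≤ Gres L (ν * (2 * Real.pi / L) ^ 2) 0 - Real.log L / (2 * Real.pi) ∧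
      Gres L (ν * (2 * Real.pi / L) ^ 2) 0 - Real.log L / (2 * Real.pi) ≤ 0.0510 + 0.234 * ν := by
  have hπlo := Real.pi_gt_d6
  have hπhi := Real.pi_lt_d6
  have hπ := Real.pi_pos
  have hL0 : (0 : ℝ) < L := by exact_mod_cast (show 0 < L by omega)
  set θ : ℝ := 2 * Real.pi / L with hθ
  have hθ0 : 0 < θ := by positivity
  -- `λ = νθ² < 2ε₁`
  have hν4 : ν < 4 / Real.pi ^ 2 := by
    rw [lt_div_iff₀ (by positivity)]; nlinarith
  have hεJ : 2 / Real.pi ^ 2 * θ ^ 2 ≤ eps1 L := by rw [hθ]; exact RateLemma.eps1_ge_jordan L (by omega)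
  have hlam0 : 0 ≤ ν * θ ^ 2 := by positivity
  have hlam1 : ν * θ ^ 2 < 2 * eps1 L := by
    have h1 : ν * θ ^ 2 < 4 / Real.pi ^ 2 * θ ^ 2 := mul_lt_mul_of_pos_right hν4 (by positivity)
    have h2 : 4 / Real.pi ^ 2 * θ ^ 2 = 2 * (2 / Real.pi ^ 2 * θ ^ 2) := by ring
    linarith
  obtain ⟨hElo, hEhi⟩ := excess_bracket L (by omega) (ν * θ ^ 2) hlam0 hlam1
  obtain ⟨hClo, hChi⟩ := capacity_const_bounds L hL
  -- the uniform `S₂` brackets at `L₀ = 64`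
  have hB := s2UniformBracket_holds L 64 (by norm_num) ⟨16, by norm_num⟩ hL ν hν0 hν4
  have hB0 := s2UniformBracket_holds L 64 (by norm_num) ⟨16, by norm_num⟩ hL 0 le_rfl (by positivity)
  rw [show (64 : ℕ) / 4 = 16 from rfl] at hB hB0
  rw [zero_mul] at hB0
  -- `λ S₂/V = (ν/(4π²))·(16π⁴ S₂/L⁴)`
  have hconv : ∀ S : ℝ, ν * θ ^ 2 * S / (L : ℝ) ^ 2 = ν / (4 * Real.pi ^ 2) * (16 * Real.pi ^ 4 * S / (L : ℝ) ^ 4) := by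
    intro S; rw [hθ]; field_simp; ring
  rw [hconv] at hElo hEhi
  have hlo5 := xi2lo_zero_ge
  have hhi9 := xi2hi_le ν hν0 hν
  have hcoef_lo : 0.1266 * ν ≤ ν / (4 * Real.pi ^ 2) * (16 * Real.pi ^ 4 * S2sum L 0 / (L : ℝ) ^ 4) := by
    have h1 : (5 : ℝ) ≤ 16 * Real.pi ^ 4 * S2sum L 0 / (L : ℝ) ^ 4 := hlo5.trans hB0.1
    have h2 : 0.1266 ≤ ν⁻¹ * 0 + 5 / (4 * Real.pi ^ 2) := by
      rw [mul_zero, zero_add, le_div_iff₀ (by positivity)]; nlinarith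
    have h3 : ν / (4 * Real.pi ^ 2) * 5 ≤ ν / (4 * Real.pi ^ 2) * (16 * Real.pi ^ 4 * S2sum L 0 / (L : ℝ) ^ 4) :=
      mul_le_mul_of_nonneg_left h1 (by positivity)
    have h4 : 0.1266 * ν ≤ ν / (4 * Real.pi ^ 2) * 5 := by
      rw [show ν / (4 * Real.pi ^ 2) * 5 = (5 / (4 * Real.pi ^ 2)) * ν by ring]
      exact mul_le_mul_of_nonneg_right (by linarith) hν0
    linarith
  have hcoef_hi : ν / (4 * Real.pi ^ 2) * (16 * Real.pi ^ 4 * S2sum L (ν * θ ^ 2) / (L : ℝ) ^ 4) ≤ 0.234 * ν := by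
    have h1 : 16 * Real.pi ^ 4 * S2sum L (ν * θ ^ 2) / (L : ℝ) ^ 4 ≤ 9.2 := by
      have := hB.2; rw [hθ]; exact this.trans hhi9
    have h3 : ν / (4 * Real.pi ^ 2) * (16 * Real.pi ^ 4 * S2sum L (ν * θ ^ 2) / (L : ℝ) ^ 4)
        ≤ ν / (4 * Real.pi ^ 2) * 9.2 := mul_le_mul_of_nonneg_left h1 (by positivity)
    have h4 : ν / (4 * Real.pi ^ 2) * 9.2 ≤ 0.234 * ν := by
      rw [show ν / (4 * Real.pi ^ 2) * 9.2 = (9.2 / (4 * Real.pi ^ 2)) * ν by ring]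
      apply mul_le_mul_of_nonneg_right _ hν0
      rw [div_le_iff₀ (by positivity)]; nlinarith
    linarith
  rw [hθ] at hElo hEhi hcoef_hi
  constructor <;> linarith

end CapacityConst

end Summit.HubbardSuperconductivity.HubbardSuperconductivity.Theorems.AnisotropyChord.Transfer.Fibre3

end
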